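import Mathlib
import HarnessLib
import Summits.QuantumFields.YangMills.Theorems.ComplexCouplingChannelContinuumLegGivenGapArrayFunctionalReflection

/-!
# Reflection positivity of Wilson's measure for wall reflections in any axis, Cauchy–Schwarz form
# (crux `ContinuumLegGivenGap`, stmt-QuantumFields-15828, line `alternating-curvature-arrays`, helper of
# `stub_arrayFunctional`)

From the tree's Osterwalder–Seiler positivity on the ODD torus (`wilsonExpectation_oddReflectionPositive`: reflection
`t ↦ 1 - t`, observables of the closed positive half) we derive, for the wall reflection `Θ = configReflect μ A` of ANY
axis `μ` through ANY wall `A/2` (`A : ℤ`; the parity of `A` decides which conjugate of the time reflection is used —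
through a link hyperplane for odd `A`, through a site hyperplane for even `A`, see
`…ArrayFunctionalReflection.configReflect_eq_conj`), and for two real continuous observables `F, G` depending only on
links strictly inside the open positive half-slab `A/2 < x_μ < A/2 + S/2` (`posSlabEdges`):
`0 ≤ ⟨F∘Θ · F⟩`, `0 ≤ ⟨G∘Θ · G⟩` and the reflection Cauchy–Schwarz inequality `⟨F∘Θ · G⟩² ≤ ⟨F∘Θ · F⟩ ⟨G∘Θ · G⟩`
(`wall_rp_cauchySchwarz`) — positivity of the quadratic form `t ↦ ⟨(F+tG)∘Θ · (F+tG)⟩` plus its symmetry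
(`Θ` is a measure-preserving involution) and the discriminant.  The transport of positivity along a measure-preserving
conjugation is `integral_reflect_mul_nonneg_of_conj` / `rp_cauchySchwarz_of_conj`.

References: K. Osterwalder, E. Seiler, Ann. Phys. 110 (1978) 440, §2; J. Fröhlich, R. Israel, E. H. Lieb, B. Simon,
Comm. Math. Phys. 62 (1978) 1, Thm. 2.1 and §2 (Schwarz inequality from reflection positivity). [folklore]
-/

set_option autoImplicit false

noncomputable section

namespace Summit.QuantumFields.YangMills.Theorems.ContinuumLegGivenGap

open MeasureTheory
open scoped ComplexConjugate
open Literature.MathematicalPhysics.QuantumFieldTheory Literature.MathematicalPhysics.QuantumLattice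

/-! ## Transport of reflection positivity along a measure-preserving conjugation -/

section Abstract

variable {d S N : ℕ} [NeZero d] [NeZero S] {G : Type*} [Group G] [TopologicalSpace G] [IsTopologicalGroup G]
  [CompactSpace G] [MeasurableSpace G] [BorelSpace G] (ρ : G →* Matrix (Fin N) (Fin N) ℂ)

omit [NeZero S] [TopologicalSpace G] [IsTopologicalGroup G] [CompactSpace G] [MeasurableSpace G] [BorelSpace G] in
/-- The time reflection is an involution. [folklore] -/
theorem timeReflect_timeReflect' (U : GaugeConfig d S G) : U.timeReflect.timeReflect = U := by
  funext e; obtain ⟨x, i⟩ := e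
  by_cases hi : i = 0
  · subst hi; simp [GaugeConfig.timeReflect]
  · simp [GaugeConfig.timeReflect, hi]

/-- **Positivity transported along a conjugation.** If `π` preserves Wilson's measure and `H ∘ π⁻¹` is an observable
of the closed positive half of the odd torus, then `⟨H ∘ Θ · H⟩ ≥ 0` for the conjugate reflection
`Θ = π⁻¹ ∘ (time reflection) ∘ π`. [folklore] -/
theorem integral_reflect_mul_nonneg_of_conj (hS : Odd S) (h3 : 3 ≤ S) (hρ : Continuous ρ) {β : ℝ} (hβ : 0 ≤ β)
    (π : GaugeConfig d S G ≃ᵐ GaugeConfig d S G)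
    (hπ : MeasurePreserving π (wilsonMeasure ρ β) (wilsonMeasure ρ β))
    {Θ : GaugeConfig d S G → GaugeConfig d S G} (hΘ : ∀ U, Θ U = π.symm (GaugeConfig.timeReflect (π U)))
    {H : GaugeConfig d S G → ℝ} (hHm : Measurable H) {C : ℝ} (hHb : ∀ U, |H U| ≤ C)
    (hHd : DependsOn (H ∘ π.symm)
      ((WilsonOddRP.oPosEdges ∪ WilsonOddRP.oSharedEdges : Finset (Edge d S)) : Set (Edge d S))) :
    0 ≤ ∫ U, H (Θ U) * H U ∂(wilsonMeasure ρ β) := by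
  set Fc : GaugeConfig d S G → ℂ := fun V => ((H (π.symm V) : ℝ) : ℂ) with hFc
  have hpos := wilsonExpectation_oddReflectionPositive (d := d) (L := S) ρ hS h3 hρ hβ Fc
    (Complex.measurable_ofReal.comp (hHm.comp π.symm.measurable))
    ⟨C, fun V => by rw [hFc, Complex.norm_real, Real.norm_eq_abs]; exact hHb _⟩
    (fun V V' h => by simp only [hFc]; rw [show H (π.symm V) = H (π.symm V') from hHd h])
  have hint : wilsonExpectation ρ β (fun V => conj (Fc V.timeReflect) * Fc V) =
      ((∫ V, H (π.symm V.timeReflect) * H (π.symm V) ∂(wilsonMeasure ρ β) : ℝ) : ℂ) := by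
    simp only [wilsonExpectation, hFc, Complex.conj_ofReal, ← Complex.ofReal_mul]
    exact integral_complex_ofReal
  rw [hint, Complex.zero_le_real, ← hπ.integral_comp π.measurableEmbedding] at hpos
  simpa only [MeasurableEquiv.symm_apply_apply, ← hΘ] using hpos

/-- **Reflection positivity in Cauchy–Schwarz form, transported along a conjugation**: for bounded measurable real
`F, G` with `F ∘ π⁻¹`, `G ∘ π⁻¹` observables of the closed positive half, and `Θ = π⁻¹ ∘ Θ₀ ∘ π`:
`0 ≤ ⟨F∘Θ · F⟩`, `0 ≤ ⟨G∘Θ · G⟩`, `⟨F∘Θ · G⟩² ≤ ⟨F∘Θ · F⟩ ⟨G∘Θ · G⟩`. [folklore] -/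
theorem rp_cauchySchwarz_of_conj (hS : Odd S) (h3 : 3 ≤ S) (hρ : Continuous ρ) {β : ℝ} (hβ : 0 ≤ β)
    (π : GaugeConfig d S G ≃ᵐ GaugeConfig d S G)
    (hπ : MeasurePreserving π (wilsonMeasure ρ β) (wilsonMeasure ρ β))
    {Θ : GaugeConfig d S G → GaugeConfig d S G} (hΘ : ∀ U, Θ U = π.symm (GaugeConfig.timeReflect (π U)))
    {F G' : GaugeConfig d S G → ℝ} (hFm : Measurable F) (hGm : Measurable G') {CF CG : ℝ}
    (hFb : ∀ U, |F U| ≤ CF) (hGb : ∀ U, |G' U| ≤ CG)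
    (hFd : DependsOn (F ∘ π.symm)
      ((WilsonOddRP.oPosEdges ∪ WilsonOddRP.oSharedEdges : Finset (Edge d S)) : Set (Edge d S)))
    (hGd : DependsOn (G' ∘ π.symm)
      ((WilsonOddRP.oPosEdges ∪ WilsonOddRP.oSharedEdges : Finset (Edge d S)) : Set (Edge d S))) :
    0 ≤ ∫ U, F (Θ U) * F U ∂(wilsonMeasure ρ β) ∧ 0 ≤ ∫ U, G' (Θ U) * G' U ∂(wilsonMeasure ρ β) ∧
      (∫ U, F (Θ U) * G' U ∂(wilsonMeasure ρ β)) ^ 2 ≤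
        (∫ U, F (Θ U) * F U ∂(wilsonMeasure ρ β)) * (∫ U, G' (Θ U) * G' U ∂(wilsonMeasure ρ β)) := by
  haveI := isProbabilityMeasure_wilsonMeasure (d := d) (L := S) ρ hρ β
  set μW := wilsonMeasure (d := d) (L := S) ρ β with hμW
  have hΘeq : Θ = fun U => π.symm (GaugeConfig.timeReflect (π U)) := funext hΘ
  have hΘm : Measurable Θ := by
    rw [hΘeq]; exact π.symm.measurable.comp (WilsonRP.measurable_timeReflect.comp π.measurable)
  have hΘmp : MeasurePreserving Θ μW μW := by
    rw [hΘeq]; exact (hπ.symm π).comp ((measurePreserving_timeReflect ρ hρ β).comp hπ)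
  have hΘΘ : ∀ U, Θ (Θ U) = U := fun U => by
    rw [hΘ, hΘ, MeasurableEquiv.apply_symm_apply, timeReflect_timeReflect', MeasurableEquiv.symm_apply_apply]
  let Θe : GaugeConfig d S G ≃ᵐ GaugeConfig d S G :=
    { toFun := Θ, invFun := Θ, left_inv := hΘΘ, right_inv := hΘΘ,
      measurable_toFun := hΘm, measurable_invFun := hΘm }
  -- integrability of the pairings
  have hI : ∀ {A B : GaugeConfig d S G → ℝ} {CA CB : ℝ}, Measurable A → Measurable B →
      (∀ U, |A U| ≤ CA) → (∀ U, |B U| ≤ CB) → Integrable (fun U => A (Θ U) * B U) μW := by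
    intro A B CA CB hA hB hAb hBb
    refine Integrable.of_bound ((hA.comp hΘm).mul hB).aestronglyMeasurable (CA * CB)
      (ae_of_all _ fun U => ?_)
    rw [Real.norm_eq_abs, abs_mul]
    exact mul_le_mul (hAb _) (hBb _) (abs_nonneg _) ((abs_nonneg _).trans (hAb (Θ U)))
  -- symmetry of the pairing
  have hsymm : ∫ U, F (Θ U) * G' U ∂μW = ∫ U, G' (Θ U) * F U ∂μW := by
    rw [← hΘmp.integral_comp Θe.measurableEmbedding (fun U => F (Θ U) * G' U)]
    refine integral_congr_ae (ae_of_all _ fun U => ?_)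
    show F (Θ (Θ U)) * G' (Θ U) = G' (Θ U) * F U
    rw [hΘΘ, mul_comm]
  -- positivity of the diagonal pairings
  have hposF := integral_reflect_mul_nonneg_of_conj ρ hS h3 hρ hβ π hπ hΘ hFm hFb hFd
  have hposG := integral_reflect_mul_nonneg_of_conj ρ hS h3 hρ hβ π hπ hΘ hGm hGb hGd
  refine ⟨hposF, hposG, ?_⟩
  -- positivity of the pairing of `F + t G` with itself, expanded
  have hquad : ∀ t : ℝ, 0 ≤ (∫ U, G' (Θ U) * G' U ∂μW) * (t * t) + (2 * ∫ U, F (Θ U) * G' U ∂μW) * t +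
      ∫ U, F (Θ U) * F U ∂μW := by
    intro t
    have hHm : Measurable fun U => F U + t * G' U := hFm.add (hGm.const_mul t)
    have hHb : ∀ U, |F U + t * G' U| ≤ CF + |t| * CG := fun U =>
      (abs_add_le _ _).trans (add_le_add (hFb U) (by rw [abs_mul]; exact mul_le_mul_of_nonneg_left (hGb U) (abs_nonneg t)))
    have hHd : DependsOn ((fun U => F U + t * G' U) ∘ π.symm)
        ((WilsonOddRP.oPosEdges ∪ WilsonOddRP.oSharedEdges : Finset (Edge d S)) : Set (Edge d S)) :=
      fun V V' h => by
        simp only [Function.comp_apply]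
        rw [show F (π.symm V) = F (π.symm V') from hFd h, show G' (π.symm V) = G' (π.symm V') from hGd h]
    have h0 := integral_reflect_mul_nonneg_of_conj ρ hS h3 hρ hβ π hπ hΘ hHm hHb hHd
    have hexp : ∫ U, (F (Θ U) + t * G' (Θ U)) * (F U + t * G' U) ∂μW =
        ∫ U, F (Θ U) * F U ∂μW + t * ∫ U, F (Θ U) * G' U ∂μW + t * ∫ U, G' (Θ U) * F U ∂μW +
          t * t * ∫ U, G' (Θ U) * G' U ∂μW := by
      have e1 : ∫ U, (F (Θ U) + t * G' (Θ U)) * (F U + t * G' U) ∂μW =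
          ∫ U, (F (Θ U) * F U + t * (F (Θ U) * G' U) + t * (G' (Θ U) * F U) + t * t * (G' (Θ U) * G' U)) ∂μW :=
        integral_congr_ae (ae_of_all _ fun U => by ring)
      have i1 : Integrable (fun U => F (Θ U) * F U) μW := hI hFm hFm hFb hFb
      have i2 : Integrable (fun U => t * (F (Θ U) * G' U)) μW := (hI hFm hGm hFb hGb).const_mul t
      have i3 : Integrable (fun U => t * (G' (Θ U) * F U)) μW := (hI hGm hFm hGb hFb).const_mul t
      have i4 : Integrable (fun U => t * t * (G' (Θ U) * G' U)) μW := (hI hGm hGm hGb hGb).const_mul (t * t)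
      have i12 : Integrable (fun U => F (Θ U) * F U + t * (F (Θ U) * G' U)) μW := i1.add i2
      have i123 : Integrable (fun U => F (Θ U) * F U + t * (F (Θ U) * G' U) + t * (G' (Θ U) * F U)) μW :=
        i12.add i3
      rw [e1, integral_add i123 i4, integral_add i12 i3, integral_add i1 i2, integral_const_mul,
        integral_const_mul, integral_const_mul]
    rw [hexp, ← hsymm] at h0
    linarith
  have hdisc := discrim_le_zero hquad
  rw [discrim] at hdisc
  nlinarith [hdisc]

end Abstract

/-! ## The open positive half-slab of a wall and the main theorem -/

section Wall

variable {d S N : ℕ} [NeZero d] [NeZero S] {G : Type*} [Group G] [TopologicalSpace G] [IsTopologicalGroup G]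
  [CompactSpace G] [MeasurableSpace G] [BorelSpace G] (ρ : G →* Matrix (Fin N) (Fin N) ℂ)

variable (S) in
/-- **The links strictly inside the open positive half-slab** of the wall `A/2` in the axis `μ` (`A : ℤ` — on the
torus `ℤ/S` the integer `A` is read mod `2S`: `A` and `A + S` give the same reflection but opposite half-slabs): the
`μ`-coordinate has a lift `Y` with `A/2 < Y` and `Y < (A + S)/2` (both endpoints of a link along `μ`). [folklore] -/
def posSlabEdges (μ : Fin d) (A : ℤ) : Set (Edge d S) :=
  {e | ∃ Y : ℤ, e.1 μ = (Y : ZMod S) ∧ A + 1 ≤ 2 * Y ∧ 2 * Y + (if e.2 = μ then 3 else 1) ≤ A + S}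

omit [NeZero d] [NeZero S] in
/-- Membership in `posSlabEdges`. [folklore] -/
theorem mem_posSlabEdges {μ : Fin d} {A : ℤ} {e : Edge d S} :
    e ∈ posSlabEdges S μ A ↔
      ∃ Y : ℤ, e.1 μ = (Y : ZMod S) ∧ A + 1 ≤ 2 * Y ∧ 2 * Y + (if e.2 = μ then 3 else 1) ≤ A + S :=
  Iff.rfl

omit [NeZero d] in
/-- The value of a small non-negative integer residue. [folklore] -/
theorem val_intCast_of_lt {t : ℤ} (h0 : 0 ≤ t) (ht : t < S) : (((t : ZMod S)).val : ℤ) = t := by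
  rw [ZMod.val_intCast, Int.emod_eq_of_lt h0 ht]

omit [NeZero S] in
/-- Positive links of the tree's odd reflection positivity, on a pair. [folklore] -/
theorem isOPosEdge_mk_iff (x : Site d S) (j : Fin d) :
    WilsonOddRP.IsOPosEdge (x, j) ↔ 1 ≤ (x 0).val ∧ (x 0).val ≤ S / 2 := Iff.rfl

omit [NeZero S] in
/-- The time coordinate read by the inverse conjugation. [folklore] -/
theorem conj_site_apply_zero (μ : Fin d) (s : ZMod S) (x : Site d S) :
    (sitePerm (Equiv.swap 0 μ) x + Pi.single 0 s : Site d S) 0 = x μ + s := by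
  rw [Pi.add_apply, sitePerm_apply, Equiv.symm_swap, Equiv.swap_apply_left, Pi.single_eq_same]

omit [Group G] [TopologicalSpace G] [IsTopologicalGroup G] [CompactSpace G] [BorelSpace G] in
/-- Odd walls: after the conjugation `conjFwd μ (-a)` (`A = 2a + 1`) a link of the open positive half-slab is read on a
positive link of the tree's odd reflection positivity. [folklore] -/
theorem dependsOn_comp_conjFwd_symm_of_odd (μ : Fin d) (a : ℤ) {α : Type*}
    {F : GaugeConfig d S G → α} (hF : DependsOn F (posSlabEdges S μ (2 * a + 1))) :
    DependsOn (F ∘ (conjFwd (G := G) μ ((-a : ℤ) : ZMod S)).symm)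
      ((WilsonOddRP.oPosEdges ∪ WilsonOddRP.oSharedEdges : Finset (Edge d S)) : Set (Edge d S)) := by
  intro V V' h
  refine hF fun e he => ?_
  obtain ⟨Y, hY, h1, h2⟩ := he
  rw [conjFwd_symm_apply_apply, conjFwd_symm_apply_apply]
  refine h _ ?_
  rw [Finset.coe_union, Set.mem_union, Finset.mem_coe, WilsonOddRP.mem_oPosEdges, isOPosEdge_mk_iff,
    conj_site_apply_zero, hY, show ((Y : ZMod S)) + ((-a : ℤ) : ZMod S) = ((Y - a : ℤ) : ZMod S) by
      push_cast; ring]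
  left
  have hv : ((((Y - a : ℤ) : ZMod S)).val : ℤ) = Y - a :=
    val_intCast_of_lt (by omega) (by split_ifs at h2 <;> omega)
  split_ifs at h2 <;> constructor <;> omega

omit [TopologicalSpace G] [IsTopologicalGroup G] [CompactSpace G] [BorelSpace G] in
/-- Even walls: after the conjugation `timeReflect ∘ conjFwd μ (L + 1 - a)` (`A = 2a`, `S = 2L + 1`) a link of the
open positive half-slab is read on a positive link of the tree's odd reflection positivity. [folklore] -/
theorem dependsOn_comp_conjFwd_symm_timeReflect_of_even {L : ℕ} (hL : S = 2 * L + 1) (μ : Fin d) (a : ℤ)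
    {α : Type*} {F : GaugeConfig d S G → α} (hF : DependsOn F (posSlabEdges S μ (2 * a))) :
    DependsOn (F ∘ (conjFwd (G := G) μ ((L + 1 - a : ℤ) : ZMod S)).symm ∘ GaugeConfig.timeReflect)
      ((WilsonOddRP.oPosEdges ∪ WilsonOddRP.oSharedEdges : Finset (Edge d S)) : Set (Edge d S)) := by
  have hS0 : (((2 * L + 1 : ℕ) : ℤ) : ZMod S) = 0 := by rw [← hL]; simp
  push_cast at hS0
  intro V V' h
  refine hF fun e he => ?_
  obtain ⟨Y, hY, h1, h2⟩ := he
  simp only [Function.comp_apply]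
  rw [conjFwd_symm_apply_apply, conjFwd_symm_apply_apply, WilsonRP.timeReflect_apply, WilsonRP.timeReflect_apply]
  have hswap : Equiv.swap (0 : Fin d) μ e.2 = 0 ↔ e.2 = μ := by
    rw [Equiv.swap_apply_eq_iff, Equiv.swap_apply_left]
  have hmem : WilsonRP.edgeReflect (sitePerm (Equiv.swap 0 μ) e.1 + Pi.single 0 ((L + 1 - a : ℤ) : ZMod S),
      Equiv.swap 0 μ e.2) ∈ ((WilsonOddRP.oPosEdges ∪ WilsonOddRP.oSharedEdges : Finset (Edge d S)) :
        Set (Edge d S)) := by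
    rw [Finset.coe_union, Set.mem_union, Finset.mem_coe, WilsonOddRP.mem_oPosEdges]
    left
    unfold WilsonRP.edgeReflect
    by_cases he2 : e.2 = μ
    · rw [if_pos (hswap.2 he2), isOPosEdge_mk_iff, WilsonRP.timeReflect_apply_zero, WilsonRP.shift_apply_self]
      dsimp only
      rw [conj_site_apply_zero, hY,
        show (1 : ZMod S) - ((Y : ZMod S) + ((L + 1 - a : ℤ) : ZMod S) + 1) = ((a - Y + L : ℤ) : ZMod S) by
          push_cast; linear_combination -hS0]
      rw [if_pos he2] at h2
      have hv : ((((a - Y + L : ℤ) : ZMod S)).val : ℤ) = a - Y + L := val_intCast_of_lt (by omega) (by omega)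
      constructor <;> omega
    · rw [if_neg (mt hswap.1 he2), isOPosEdge_mk_iff, WilsonRP.timeReflect_apply_zero]
      dsimp only
      rw [conj_site_apply_zero, hY,
        show (1 : ZMod S) - ((Y : ZMod S) + ((L + 1 - a : ℤ) : ZMod S)) = ((a - Y + L + 1 : ℤ) : ZMod S) by
          push_cast; linear_combination -hS0]
      rw [if_neg he2] at h2
      have hv : ((((a - Y + L + 1 : ℤ) : ZMod S)).val : ℤ) = a - Y + L + 1 :=
        val_intCast_of_lt (by omega) (by omega)
      constructor <;> omega
  split_ifs with h0
  · rw [h _ hmem]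
  · rw [h _ hmem]

variable [SecondCountableTopology G]

/-- **Reflection positivity for wall reflections in any axis, Cauchy–Schwarz form.** On the odd torus `(ℤ/S)^d`,
`S ≥ 3`, with a continuous representation `ρ` and `β ≥ 0`: for the reflection `Θ = configReflect μ A` of the axis `μ`
through the wall `A/2` (`A : ℤ`) and real continuous observables `F, G` depending only on the links strictly inside
the open positive half-slab (`posSlabEdges S μ A`), `0 ≤ ⟨F∘Θ · F⟩`, `0 ≤ ⟨G∘Θ · G⟩` and
`⟨F∘Θ · G⟩² ≤ ⟨F∘Θ · F⟩ · ⟨G∘Θ · G⟩`. [folklore] -/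
theorem wall_rp_cauchySchwarz (hS : Odd S) (h3 : 3 ≤ S) (hρ : Continuous ρ) {β : ℝ} (hβ : 0 ≤ β) (μ : Fin d)
    (A : ℤ) {F G' : GaugeConfig d S G → ℝ} (hFc : Continuous F) (hGc : Continuous G')
    (hFd : DependsOn F (posSlabEdges S μ A)) (hGd : DependsOn G' (posSlabEdges S μ A)) :
    0 ≤ ∫ U, F (configReflect μ (A : ZMod S) U) * F U ∂(wilsonMeasure ρ β) ∧
      0 ≤ ∫ U, G' (configReflect μ (A : ZMod S) U) * G' U ∂(wilsonMeasure ρ β) ∧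
      (∫ U, F (configReflect μ (A : ZMod S) U) * G' U ∂(wilsonMeasure ρ β)) ^ 2 ≤
        (∫ U, F (configReflect μ (A : ZMod S) U) * F U ∂(wilsonMeasure ρ β)) *
          (∫ U, G' (configReflect μ (A : ZMod S) U) * G' U ∂(wilsonMeasure ρ β)) := by
  obtain ⟨CF, hCF⟩ := isCompact_univ.exists_bound_of_continuousOn hFc.continuousOn
  obtain ⟨CG, hCG⟩ := isCompact_univ.exists_bound_of_continuousOn hGc.continuousOn
  have hFb : ∀ U, |F U| ≤ CF := fun U => by rw [← Real.norm_eq_abs]; exact hCF U (Set.mem_univ _)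
  have hGb : ∀ U, |G' U| ≤ CG := fun U => by rw [← Real.norm_eq_abs]; exact hCG U (Set.mem_univ _)
  obtain ⟨a, rfl | rfl⟩ := Int.even_or_odd' A
  · -- even wall `A = 2a`: a site hyperplane; conjugate by `timeReflect ∘ conjFwd μ (L + 1 - a)`
    obtain ⟨L, hL⟩ := hS
    set s : ZMod S := ((L + 1 - a : ℤ) : ZMod S) with hs
    have hA : (((2 * a : ℤ)) : ZMod S) = 1 - 2 * s := by
      have hS0 : (((2 * L + 1 : ℕ) : ℤ) : ZMod S) = 0 := by rw [← hL]; simp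
      rw [hs]; push_cast at hS0 ⊢; linear_combination hS0
    set π : GaugeConfig d S G ≃ᵐ GaugeConfig d S G := (conjFwd μ s).trans timeReflectEquiv with hπ
    have hπmp : MeasurePreserving π (wilsonMeasure ρ β) (wilsonMeasure ρ β) :=
      (measurePreserving_timeReflect ρ hρ β).comp (measurePreserving_conjFwd ρ hρ β μ s)
    have hΘ : ∀ U, configReflect μ (((2 * a : ℤ)) : ZMod S) U = π.symm (GaugeConfig.timeReflect (π U)) := by
      intro U
      rw [hA, configReflect_eq_conj]
      show _ = (conjFwd μ s).symm (GaugeConfig.timeReflect (GaugeConfig.timeReflect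
        (GaugeConfig.timeReflect (conjFwd μ s U))))
      rw [timeReflect_timeReflect']
    have hsymm : ∀ (H : GaugeConfig d S G → ℝ), H ∘ π.symm = H ∘ (conjFwd μ s).symm ∘ GaugeConfig.timeReflect :=
      fun H => rfl
    have hFd' := dependsOn_comp_conjFwd_symm_timeReflect_of_even (G := G) (hL.trans (by ring)) μ a hFd
    have hGd' := dependsOn_comp_conjFwd_symm_timeReflect_of_even (G := G) (hL.trans (by ring)) μ a hGd
    rw [← hs, ← hsymm] at hFd' hGd'
    exact rp_cauchySchwarz_of_conj ρ ⟨L, hL⟩ h3 hρ hβ π hπmp hΘ hFc.measurable hGc.measurable hFb hGb hFd' hGd'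
  · -- odd wall `A = 2a + 1`: a link hyperplane; conjugate by `conjFwd μ (-a)`
    set s : ZMod S := ((-a : ℤ) : ZMod S) with hs
    have hA : (((2 * a + 1 : ℤ)) : ZMod S) = 1 - 2 * s := by rw [hs]; push_cast; ring
    set π : GaugeConfig d S G ≃ᵐ GaugeConfig d S G := conjFwd μ s with hπ
    have hΘ : ∀ U, configReflect μ (((2 * a + 1 : ℤ)) : ZMod S) U = π.symm (GaugeConfig.timeReflect (π U)) :=
      fun U => by rw [hA, configReflect_eq_conj]
    have hFd' := dependsOn_comp_conjFwd_symm_of_odd (G := G) μ a hFd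
    have hGd' := dependsOn_comp_conjFwd_symm_of_odd (G := G) μ a hGd
    rw [← hs] at hFd' hGd'
    exact rp_cauchySchwarz_of_conj ρ hS h3 hρ hβ π (measurePreserving_conjFwd ρ hρ β μ s) hΘ hFc.measurable
      hGc.measurable hFb hGb hFd' hGd'

end Wall

/-- Anchor of this helper file (registered sub-goal of stmt-QuantumFields-15828, helper of `stub_arrayFunctional`):
the reflection Cauchy–Schwarz inequality for wall reflections in any axis of the odd torus. [folklore] -/
theorem arrayFunctional_anchor_rp :
    ∀ {d S N : ℕ} [NeZero d] [NeZero S] {G : Type} [Group G] [TopologicalSpace G] [IsTopologicalGroup G]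
      [CompactSpace G] [MeasurableSpace G] [BorelSpace G] [SecondCountableTopology G]
      (ρ : G →* Matrix (Fin N) (Fin N) ℂ), Odd S → 3 ≤ S → Continuous ρ → ∀ (β : ℝ), 0 ≤ β →
      ∀ (μ : Fin d) (A : ℤ) (F G' : GaugeConfig d S G → ℝ), Continuous F → Continuous G' →
      DependsOn F (posSlabEdges S μ A) → DependsOn G' (posSlabEdges S μ A) →
      (∫ U, F (configReflect μ (A : ZMod S) U) * G' U ∂(wilsonMeasure ρ β)) ^ 2 ≤
        (∫ U, F (configReflect μ (A : ZMod S) U) * F U ∂(wilsonMeasure ρ β)) *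
          (∫ U, G' (configReflect μ (A : ZMod S) U) * G' U ∂(wilsonMeasure ρ β)) :=
  fun ρ hS h3 hρ _ hβ μ A _ _ hFc hGc hFd hGd =>
    (wall_rp_cauchySchwarz ρ hS h3 hρ hβ μ A hFc hGc hFd hGd).2.2

end Summit.QuantumFields.YangMills.Theorems.ContinuumLegGivenGap

end
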